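import Mathlib
import Summits.MatrixMultiplication.MatrixMultiplication.Theorems.FidelityWitnessesFidelityThesisStubGramSchurBound
import Summits.MatrixMultiplication.MatrixMultiplication.Theorems.FidelityWitnessesFidelityThesisStubWeylParseval
import Summits.MatrixMultiplication.MatrixMultiplication.Theorems.FidelityWitnessesFidelityThesisStubParabolaSum

/-!
# Line `Sketch` for crux `FidelityWitnesses.FidelityThesis` (stmt-MatrixMultiplication-4956) —
stub `stub_chirpInjectiveNorm`: the injective norm of the chirp tensor

For an odd prime `N` and `e = ZMod.stdAddChar` (`j ↦ exp(2πi j/N)`), the "chirp tensor"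
`Z_N(k,b,c) = [b = c + k] · e(k² c)` on `(ℤ/N)³` has as `k`-slices the `N` unitaries `Z^{k²} X^k`.
The stub bounds its injective norm (ℓ² on the `k` slot): for all `f, g : ℤ/N → ℂ`,
`∑_k |∑_{b,c} f_b g_c Z_N(k,b,c)|² ≤ √(2N − 1) · ‖f‖² ‖g‖²`.

Proof.  (1) The indicator collapses the `c`-sum: `∑_{b,c} f_b g_c Z_N(k,b,c) = ∑_b f_b x_k(b)` with
`x_k(b) = g(b − k) e(k²(b − k))` (`chirpInjectiveNorm_collapse`).  (2) The Gram–Schur bound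
(`stub_gramSchurBound`) gives `∑_k |∑_b f_b x_k(b)|² ≤ ‖G‖_F ‖f‖²` for the Gram matrix
`G_{kk'} = ∑_b conj(x_k(b)) x_{k'}(b)`.  (3) Reindexing `b ↦ b + k` shows
`G_{kk'} = e(k'²(k − k')) · A_g(k' − k, k'² − k²)` with the ambiguity function
`A_g(s,t) = ∑_b conj(g b) g(b − s) e(t b)` (`chirpInjectiveNorm_gram`), so `|G_{kk'}| = |A_g(k' − k, k'² − k²)|`.
(4) The parabola change of variables (`stub_parabolaSum`) gives
`‖G‖_F² = N |A_g(0,0)|² + ∑_{s ≠ 0} ∑_t |A_g(s,t)|²`, and `A_g(0,0) = ‖g‖²` while Plancherel for the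
ambiguity function (`stub_weylParseval`) gives `∑_{s,t} |A_g(s,t)|² = N ‖g‖⁴`; dropping the nonnegative
terms `(0, t)`, `t ≠ 0`, yields `‖G‖_F² ≤ N‖g‖⁴ + (N − 1)‖g‖⁴ = (2N − 1)‖g‖⁴`.
Supports item `stmt-MatrixMultiplication-4956`; no definitions; Mathlib plus the three landed stubs.
-/

namespace Summit.MatrixMultiplication.MatrixMultiplication.Theorems

open scoped BigOperators ComplexConjugate

/-- Collapse of the indicator sum: `∑_c f_b g_c [b = c + k] e(k² c) = f_b · g(b − k) e(k²(b − k))`,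
since `b = c + k ↔ c = b − k`. [folklore] -/
theorem chirpInjectiveNorm_collapse {N : ℕ} [NeZero N] (f g : ZMod N → ℂ) (k b : ZMod N) :
    ∑ c : ZMod N, f b * g c * (if b = c + k then (ZMod.stdAddChar (k ^ 2 * c) : ℂ) else 0) =
      f b * (g (b - k) * ZMod.stdAddChar (k ^ 2 * (b - k))) := by
  rw [Finset.sum_eq_single (b - k)]
  · rw [if_pos (sub_add_cancel b k).symm, mul_assoc]
  · intro c _ hc
    rw [if_neg, mul_zero]
    rintro rfl
    exact hc (add_sub_cancel_right c k).symm
  · intro h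
    exact absurd (Finset.mem_univ _) h

/-- Gram entries of the chirp slices `x_k(b) = g(b − k) e(k²(b − k))`: after the reindexing
`b ↦ b + k`, `∑_b conj(x_k(b)) x_{k'}(b) = e(k'²(k − k')) · ∑_b conj(g b) g(b − (k' − k)) e((k'² − k²) b)`,
using `conj(e(y)) = e(−y)` and `e(y) e(y') = e(y + y')`. [folklore] -/
theorem chirpInjectiveNorm_gram {N : ℕ} [NeZero N] (g : ZMod N → ℂ) (k k' : ZMod N) :
    ∑ b : ZMod N, conj (g (b - k) * ZMod.stdAddChar (k ^ 2 * (b - k))) *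
        (g (b - k') * ZMod.stdAddChar (k' ^ 2 * (b - k'))) =
      ZMod.stdAddChar (k' ^ 2 * (k - k')) *
        ∑ b : ZMod N, conj (g b) * g (b - (k' - k)) * (ZMod.stdAddChar ((k' ^ 2 - k ^ 2) * b) : ℂ) := by
  rw [Finset.mul_sum]
  refine (Fintype.sum_equiv (Equiv.addRight k) _ _ fun b => ?_).symm
  simp only [Equiv.coe_addRight, add_sub_cancel_right]
  rw [map_mul (starRingEnd ℂ), ← AddChar.map_neg_eq_conj, show b + k - k' = b - (k' - k) by ring]
  have hchar : (ZMod.stdAddChar (k' ^ 2 * (k - k')) : ℂ) * ZMod.stdAddChar ((k' ^ 2 - k ^ 2) * b) =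
      ZMod.stdAddChar (-(k ^ 2 * b)) * ZMod.stdAddChar (k' ^ 2 * (b - (k' - k))) := by
    rw [← AddChar.map_add_eq_mul, ← AddChar.map_add_eq_mul]
    congr 1
    ring
  linear_combination (conj (g b) * g (b - (k' - k))) * hchar

/-- **Injective norm of the chirp tensor.** For an odd prime `N`, `e = ZMod.stdAddChar` and all
`f, g : ℤ/N → ℂ`: `∑_k |∑_{b,c} f_b g_c [b = c + k] e(k² c)|² ≤ √(2N − 1) · ‖f‖² ‖g‖²`.
Collapse the `c`-sum (`chirpInjectiveNorm_collapse`), apply the Gram–Schur bound (`stub_gramSchurBound`),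
identify the Gram entries with values of the ambiguity function `A_g` on the parabolas
(`chirpInjectiveNorm_gram`), resum with `stub_parabolaSum`, and bound by `A_g(0,0) = ‖g‖²` and
Plancherel `∑_{s,t} |A_g(s,t)|² = N‖g‖⁴` (`stub_weylParseval`): `‖G‖_F² ≤ (2N − 1)‖g‖⁴`. [folklore] -/
theorem stub_chirpInjectiveNorm {N : ℕ} [Fact (Nat.Prime N)] (hN : N ≠ 2) (f g : ZMod N → ℂ) :
    ∑ k : ZMod N, ‖∑ b : ZMod N, ∑ c : ZMod N,
        f b * g c * (if b = c + k then (ZMod.stdAddChar (k ^ 2 * c) : ℂ) else 0)‖ ^ 2 ≤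
      Real.sqrt (2 * N - 1) * ((∑ b, ‖f b‖ ^ 2) * ∑ c, ‖g c‖ ^ 2) := by
  classical
  -- the chirp slices `x_k(b) = g(b - k) e(k²(b - k))`, kept opaque
  obtain ⟨x, hx⟩ : ∃ x : ZMod N → ZMod N → ℂ,
      ∀ k b, g (b - k) * (ZMod.stdAddChar (k ^ 2 * (b - k)) : ℂ) = x k b := ⟨_, fun _ _ => rfl⟩
  -- the ambiguity function `A_g(s,t) = ∑_b conj(g b) g(b - s) e(t b)`, kept opaque
  obtain ⟨A, hA⟩ : ∃ A : ZMod N → ZMod N → ℂ, ∀ s t,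
      ∑ b : ZMod N, conj (g b) * g (b - s) * (ZMod.stdAddChar (t * b) : ℂ) = A s t :=
    ⟨_, fun _ _ => rfl⟩
  -- Step 1: collapse the `c`-sum
  have hL : (∑ k : ZMod N, ‖∑ b : ZMod N, ∑ c : ZMod N,
      f b * g c * (if b = c + k then (ZMod.stdAddChar (k ^ 2 * c) : ℂ) else 0)‖ ^ 2) =
      ∑ k, ‖∑ b, f b * x k b‖ ^ 2 := by
    refine Finset.sum_congr rfl fun k _ => ?_
    congr 2
    exact Finset.sum_congr rfl fun b _ => by rw [chirpInjectiveNorm_collapse, hx]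
  rw [hL]
  -- Step 2: the Gram–Schur bound
  refine (stub_gramSchurBound x f).trans ?_
  -- Step 3: the Gram entries are values of the ambiguity function on parabolas
  have hG : ∀ k k' : ZMod N, ‖∑ b, conj (x k b) * x k' b‖ = ‖A (k' - k) (k' ^ 2 - k ^ 2)‖ := by
    intro k k'
    simp_rw [← hx]
    rw [chirpInjectiveNorm_gram, norm_mul, AddChar.norm_apply, one_mul, hA]
  -- Step 4: the parabola resummation
  have hsum : ∑ k : ZMod N, ∑ k' : ZMod N, ‖∑ b, conj (x k b) * x k' b‖ ^ 2 =
      (N : ℝ) * ‖A 0 0‖ ^ 2 +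
        ∑ s ∈ (Finset.univ : Finset (ZMod N)).erase 0, ∑ t : ZMod N, ‖A s t‖ ^ 2 := by
    simp_rw [hG]
    exact stub_parabolaSum hN (fun s t => ‖A s t‖ ^ 2)
  -- Step 5: `A_g(0,0) = ‖g‖²`, Plancherel, and dropping the terms `(0, t)`, `t ≠ 0`
  set S : ℝ := ∑ c, ‖g c‖ ^ 2 with hS_def
  have hS : 0 ≤ S := Finset.sum_nonneg fun _ _ => sq_nonneg _
  have hA00 : ‖A 0 0‖ = S := by
    have h0 : A 0 0 = ((S : ℝ) : ℂ) := by
      rw [← hA, hS_def, Complex.ofReal_sum]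
      refine Finset.sum_congr rfl fun b _ => ?_
      rw [sub_zero, zero_mul, AddChar.map_zero_eq_one, mul_one, Complex.ofReal_pow,
        Complex.conj_mul']
    rw [h0, Complex.norm_real, Real.norm_of_nonneg hS]
  have hWeyl : ∑ s : ZMod N, ∑ t : ZMod N, ‖A s t‖ ^ 2 = (N : ℝ) * S ^ 2 := by
    simp_rw [← hA]
    exact stub_weylParseval g
  have herase : ∑ s ∈ (Finset.univ : Finset (ZMod N)).erase 0, ∑ t : ZMod N, ‖A s t‖ ^ 2 ≤
      (N : ℝ) * S ^ 2 - S ^ 2 := by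
    have h := Finset.add_sum_erase Finset.univ (fun s : ZMod N => ∑ t : ZMod N, ‖A s t‖ ^ 2)
      (Finset.mem_univ (0 : ZMod N))
    have h0 : S ^ 2 ≤ ∑ t : ZMod N, ‖A 0 t‖ ^ 2 := by
      rw [← hA00]
      exact Finset.single_le_sum (f := fun t : ZMod N => ‖A 0 t‖ ^ 2) (fun t _ => sq_nonneg _)
        (Finset.mem_univ (0 : ZMod N))
    rw [hWeyl] at h
    linarith
  have hF : 0 ≤ ∑ b, ‖f b‖ ^ 2 := Finset.sum_nonneg fun _ _ => sq_nonneg _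
  have hsqrt : Real.sqrt (∑ k : ZMod N, ∑ k' : ZMod N, ‖∑ b, conj (x k b) * x k' b‖ ^ 2) ≤
      Real.sqrt (2 * N - 1) * S := by
    rw [hsum, hA00]
    calc Real.sqrt ((N : ℝ) * S ^ 2 +
          ∑ s ∈ (Finset.univ : Finset (ZMod N)).erase 0, ∑ t : ZMod N, ‖A s t‖ ^ 2)
        ≤ Real.sqrt ((2 * N - 1) * S ^ 2) := Real.sqrt_le_sqrt (by linarith)
      _ = Real.sqrt (2 * N - 1) * S := by rw [Real.sqrt_mul' _ (sq_nonneg S), Real.sqrt_sq hS]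
  calc Real.sqrt (∑ k : ZMod N, ∑ k' : ZMod N, ‖∑ b, conj (x k b) * x k' b‖ ^ 2) * ∑ b, ‖f b‖ ^ 2
      ≤ Real.sqrt (2 * N - 1) * S * ∑ b, ‖f b‖ ^ 2 := mul_le_mul_of_nonneg_right hsqrt hF
    _ = Real.sqrt (2 * N - 1) * ((∑ b, ‖f b‖ ^ 2) * S) := by ring

end Summit.MatrixMultiplication.MatrixMultiplication.Theorems
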